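import Summits.Ventures.PercRepro.ProfileGapMonoThresholdWeakAverageTwo

/-!
# PercRepro — THE WEAK AVERAGED STEP AT `(2, 3)` ON EVERY MATROID WITHOUT A PARALLEL PAIR (loops allowed)
(p5, gen 27; `proofs/P5-GM1.md` §26(c))

A loop `ℓ` doubles both the threshold demand and the level-set count (`thresholdSum_loop`,
`card_levelSetCoQ_loop`), in `N` and in every deletion `N ∖ y` (`y ≠ ℓ`, where `ℓ` is still a loop and
`(N ∖ y) ∖ ℓ = (N ∖ ℓ) ∖ y`).  So the averaged step of `N` follows from the averaged step of `N ∖ ℓ` and the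
threshold inequality `(I_t)` of `N ∖ ℓ` (`Φ_t(N ∖ ℓ) ≥ 0`):
`Σ_{y ∈ E} Φ_t(N ∖ y) = Φ_t(N ∖ ℓ) + 2 Σ_{y ≠ ℓ} Φ_t((N ∖ ℓ) ∖ y) ≤ (2 #E − 1) Φ_t(N ∖ ℓ) ≤ #E · Φ_t(N)`
(`weakAvg_step_of_loop`, every `q`, `t`).  At `(q, t) = (2, 3)` the input `(I_3)` is the theorem `thresholdIneq_two`,
and the induction on `#E` ends at the simple matroids (`weakAvg_two_three_of_simple`): **the weak averaged step
holds at `(2, 3)` on every finite matroid without a parallel pair** (`weakAvg_two_three_of_no_parallel`), with the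
deletion rule as corollary (`exists_delMonoT_two_three_of_no_parallel`).  Parallel pairs remain open; nothing here
asserts `WeakAvgStepT`.

* `delete_singleton_comm`, `card_levelSetCoQ_congr`, `thresholdSum_congr`, `loop_of_delete`, **`weakAvg_step_of_loop`**, `weakAvg_two_three_aux`,
  **`weakAvg_two_three_of_no_parallel`**, `exists_delMonoT_two_three_of_no_parallel`.
-/

open scoped Matroid

namespace PercRepro.Cogirth

open Finset ThmH Skew Shadow Profile

variable {α : Type} [DecidableEq α] {M : Matroid α} [M.Finite]

section Loop

variable {N : Matroid α} [N.Finite] {q t : ℕ}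

omit [DecidableEq α] in
/-- Deletions of single points commute. -/
theorem delete_singleton_comm (N : Matroid α) (y ℓ : α) :
    (N ＼ ({y} : Set α)) ＼ ({ℓ} : Set α) = (N ＼ ({ℓ} : Set α)) ＼ ({y} : Set α) := by
  rw [Matroid.delete_delete, Matroid.delete_delete, Set.union_comm]

/-- The level-set count transported along an equality of matroids. -/
theorem card_levelSetCoQ_congr {N₁ N₂ : Matroid α} [N₁.Finite] [N₂.Finite] (h : N₁ = N₂) (t q : ℕ) :
    (levelSetCoQ N₁ t q).card = (levelSetCoQ N₂ t q).card := by
  subst h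
  rfl

/-- The threshold demand transported along an equality of matroids. -/
theorem thresholdSum_congr {N₁ N₂ : Matroid α} [N₁.Finite] [N₂.Finite] (h : N₁ = N₂) (q t : ℕ) :
    thresholdSum N₁ q t = thresholdSum N₂ q t := by
  subst h
  rfl

/-- A loop of `N` is a loop of `N ∖ y` for every other point `y`. -/
theorem loop_of_delete {ℓ y : α} (hℓ : ℓ ∈ gr N) (h0 : rk N {ℓ} = 0) (hy : y ∈ (gr N).erase ℓ) :
    ℓ ∈ gr (N ＼ ({y} : Set α)) ∧ rk (N ＼ ({y} : Set α)) {ℓ} = 0 := by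
  rw [mem_erase] at hy
  obtain ⟨hyℓ, _⟩ := hy
  have hmem : ℓ ∈ (gr N).erase y := mem_erase.2 ⟨fun h => hyℓ h.symm, hℓ⟩
  refine ⟨by rw [gr_delete']; exact hmem, ?_⟩
  rw [rk_delete (singleton_subset_iff.2 hmem)]
  exact h0

/-- **The averaged step at a loop**: if `ℓ` is a loop of `N`, the weak averaged step of `N` follows from the
weak averaged step of `N ∖ ℓ` and `(I_t)` of `N ∖ ℓ` (both sides of everything double). -/
theorem weakAvg_step_of_loop {ℓ : α} (hℓ : ℓ ∈ gr N) (h0 : rk N {ℓ} = 0)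
    (hI : ThresholdIneq (N ＼ ({ℓ} : Set α)) q t)
    (hW : ∑ z ∈ gr (N ＼ ({ℓ} : Set α)),
        q * (levelSetCoQ ((N ＼ ({ℓ} : Set α)) ＼ ({z} : Set α)) t q).card +
        (gr (N ＼ ({ℓ} : Set α))).card * thresholdSum (N ＼ ({ℓ} : Set α)) q t ≤
      ∑ z ∈ gr (N ＼ ({ℓ} : Set α)), thresholdSum ((N ＼ ({ℓ} : Set α)) ＼ ({z} : Set α)) q t +
        (gr (N ＼ ({ℓ} : Set α))).card * (q * (levelSetCoQ (N ＼ ({ℓ} : Set α)) t q).card)) :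
    ∑ z ∈ gr N, q * (levelSetCoQ (N ＼ ({z} : Set α)) t q).card + (gr N).card * thresholdSum N q t ≤
      ∑ z ∈ gr N, thresholdSum (N ＼ ({z} : Set α)) q t + (gr N).card * (q * (levelSetCoQ N t q).card) := by
  -- the `y`-terms, `y ≠ ℓ`, double
  have h1 : ∀ y ∈ (gr N).erase ℓ,
      q * (levelSetCoQ (N ＼ ({y} : Set α)) t q).card =
        2 * (q * (levelSetCoQ ((N ＼ ({ℓ} : Set α)) ＼ ({y} : Set α)) t q).card) := by
    intro y hy
    obtain ⟨hℓy, h0y⟩ := loop_of_delete hℓ h0 hy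
    rw [card_levelSetCoQ_loop hℓy h0y, card_levelSetCoQ_congr (delete_singleton_comm N y ℓ), mul_left_comm]
  have h2 : ∀ y ∈ (gr N).erase ℓ,
      thresholdSum (N ＼ ({y} : Set α)) q t =
        2 * thresholdSum ((N ＼ ({ℓ} : Set α)) ＼ ({y} : Set α)) q t := by
    intro y hy
    obtain ⟨hℓy, h0y⟩ := loop_of_delete hℓ h0 hy
    rw [thresholdSum_loop hℓy h0y, thresholdSum_congr (delete_singleton_comm N y ℓ)]
  -- split both sums at `ℓ`
  rw [← add_sum_erase (gr N) _ hℓ, ← add_sum_erase (gr N) _ hℓ, sum_congr rfl h1, sum_congr rfl h2]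
  -- the `N`-level quantities double, and `#E = #(E ∖ ℓ) + 1`
  have hT := card_levelSetCoQ_loop hℓ h0 t q
  have hTS := thresholdSum_loop (q := q) (t := t) hℓ h0
  have hn : (gr N).card = ((gr N).erase ℓ).card + 1 := by
    rw [card_erase_of_mem hℓ]
    have := card_pos.2 ⟨ℓ, hℓ⟩
    omega
  rw [gr_delete'] at hW
  unfold ThresholdIneq at hI
  rw [hT, hTS, hn]
  simp only [← mul_sum] at hW ⊢
  have e1 : (((gr N).erase ℓ).card + 1) * (2 * thresholdSum (N ＼ ({ℓ} : Set α)) q t) =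
      2 * (((gr N).erase ℓ).card * thresholdSum (N ＼ ({ℓ} : Set α)) q t) +
        2 * thresholdSum (N ＼ ({ℓ} : Set α)) q t := by ring
  have e2 : (((gr N).erase ℓ).card + 1) * (q * (2 * (levelSetCoQ (N ＼ ({ℓ} : Set α)) t q).card)) =
      2 * (((gr N).erase ℓ).card * (q * (levelSetCoQ (N ＼ ({ℓ} : Set α)) t q).card)) +
        2 * (q * (levelSetCoQ (N ＼ ({ℓ} : Set α)) t q).card) := by ring
  rw [e1, e2]
  omega

end Loop

section NoParallel

variable {N : Matroid α} [N.Finite]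

/-- The induction on `#E`: loops reduce by `weakAvg_step_of_loop`, loopless matroids without a parallel pair are
simple. -/
theorem weakAvg_two_three_aux (n : ℕ) :
    ∀ (N : Matroid α) [N.Finite], (gr N).card = n →
      (∀ x ∈ gr N, ∀ y ∈ gr N, x ≠ y → rk N {x} = 1 → rk N {y} = 1 → rk N {x, y} ≠ 1) →
      ∑ z ∈ gr N, 2 * (levelSetCoQ (N ＼ ({z} : Set α)) 3 2).card + (gr N).card * thresholdSum N 2 3 ≤
        ∑ z ∈ gr N, thresholdSum (N ＼ ({z} : Set α)) 2 3 + (gr N).card * (2 * (levelSetCoQ N 3 2).card) := by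
  induction n using Nat.strong_induction_on with
  | _ n ih =>
  intro N _ hN hpar
  -- a loop
  by_cases hloop : ∃ ℓ ∈ gr N, rk N {ℓ} = 0
  · obtain ⟨ℓ, hℓ, h0⟩ := hloop
    have hlt : ((gr N).erase ℓ).card < n := by rw [← hN]; exact card_erase_lt_of_mem hℓ
    have hpar' : ∀ x ∈ gr (N ＼ ({ℓ} : Set α)), ∀ y ∈ gr (N ＼ ({ℓ} : Set α)), x ≠ y →
        rk (N ＼ ({ℓ} : Set α)) {x} = 1 → rk (N ＼ ({ℓ} : Set α)) {y} = 1 →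
        rk (N ＼ ({ℓ} : Set α)) {x, y} ≠ 1 := by
      intro x hx y hy hxy
      rw [gr_delete'] at hx hy
      rw [rk_delete (singleton_subset_iff.2 hx), rk_delete (singleton_subset_iff.2 hy),
        rk_delete (insert_subset hx (singleton_subset_iff.2 hy))]
      exact hpar x (mem_of_mem_erase hx) y (mem_of_mem_erase hy) hxy
    have hW := ih _ hlt (N ＼ ({ℓ} : Set α)) (by rw [gr_delete']) hpar'
    exact weakAvg_step_of_loop hℓ h0 (thresholdIneq_two _ (by norm_num)) hW
  -- loopless: simple
  have hloop' : ∀ x ∈ gr N, rk N {x} = 1 := by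
    intro x hx
    have h2 : rk N {x} ≠ 0 := fun h => hloop ⟨x, hx, h⟩
    have h3 : rk N {x} ≤ 1 := by
      have := rk_le_card (M := N) ({x} : Finset α)
      simpa using this
    omega
  exact weakAvg_two_three_of_simple hloop'
    (fun x hx y hy hxy => hpar x hx y hy hxy (hloop' x hx) (hloop' y hy))

/-- **THE WEAK AVERAGED STEP AT `(q, t) = (2, 3)` ON EVERY MATROID WITHOUT A PARALLEL PAIR** (loops and coloops
allowed): `Σ_{z ∈ E} Φ_3(N ∖ z) ≤ #E · Φ_3(N)` at co-rank `2`, the body of `WeakAvgStepT α 2 3` at `N`. -/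
theorem weakAvg_two_three_of_no_parallel
    (hpar : ∀ x ∈ gr N, ∀ y ∈ gr N, x ≠ y → rk N {x} = 1 → rk N {y} = 1 → rk N {x, y} ≠ 1) :
    ∑ z ∈ gr N, 2 * (levelSetCoQ (N ＼ ({z} : Set α)) 3 2).card + (gr N).card * thresholdSum N 2 3 ≤
      ∑ z ∈ gr N, thresholdSum (N ＼ ({z} : Set α)) 2 3 + (gr N).card * (2 * (levelSetCoQ N 3 2).card) :=
  weakAvg_two_three_aux _ N rfl hpar

/-- **The deletion rule at `(2, 3)` on every matroid without a parallel pair.** -/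
theorem exists_delMonoT_two_three_of_no_parallel
    (hpar : ∀ x ∈ gr N, ∀ y ∈ gr N, x ≠ y → rk N {x} = 1 → rk N {y} = 1 → rk N {x, y} ≠ 1)
    (hne : (gr N).Nonempty) : ∃ z ∈ gr N, DelMonoT N z 2 3 :=
  exists_delMonoT_of_weakAvg hne (weakAvg_two_three_of_no_parallel hpar)

end NoParallel

end PercRepro.Cogirth
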